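import Summits.QuantumFields.YangMills.Theorems.QuantileBitPurityFluxBound
import Summits.QuantumFields.YangMills.Theorems.QuantileBitPuritySectorGoodReduction
import HarnessLib

/-!
# Flux reflection on the good-field event: the `x`-twisted sector total against ONE periodic thin equator band at slice `0` plus bad fields

Support module (`--supports` stmt-QuantumFields-24093, `QuantileBitPurity.EquatorBandVanishing`; seat ym-dw-p1 g17, LINE g12-B of ideator seat ym-idea-4).
Continues `QuantileBitPurityFluxBound`: on the good-field event `TT.goodEvent n z s t` (consecutive slices linkwise `t`-close) slice `k` is `kt`-close to
slice `0`, so a sign flip of `Re tr P_x` between slices `0` and `k`, a vanishing `Re tr P_x(U₀)`, and the thin band at slice `k` all live inside ONE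
equator band `B = {|Re tr P_x(U₀)| ≤ 2L(q+3)t}` at slice `0`, while the far antipodal bond is a bad field.  Hence

★ `sectorWeight_twisted_le_band_odd` (ring of `2q+3` slices) and ★ `sectorWeight_twisted_le_band_even` (ring of `2q+2` slices):
`W_z(1) ≤ 3·√W_0(1)·√(W_0(𝟙_B(U₀)) + W_0(goodᶜ)) + W_0(𝟙_B(U₀)) + W_0(goodᶜ) + W_z(goodᶜ)` (the last two terms absent in the even case)
for every `x`-twisted sector `z` (`z 0 = true`) and `β ≥ 0`.  HONEST FRAMING: fixed-lattice transfer-matrix inequality; nothing about infinite volume,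
the continuum limit or the Clay gap.  No `sorry`, no new axiom, no new definition.  References: [cite: tHooft1979]; [cite: Luscher1983, §2].
-/

set_option autoImplicit false

noncomputable section

open MeasureTheory Filter Topology Real Function
open scoped BigOperators
open Literature.MathematicalPhysics.QuantumLattice
open Literature.MathematicalPhysics.QuantumFieldTheory hiding SU2
open Literature.Analysis.OperatorTheory
open Summit.QuantumFields.YangMills.Theorems

namespace Summit.QuantumFields.YangMills.Theorems.FemtoTransferGap.TT

open Summit.QuantumFields.YangMills.Theorems.FemtoTransferGap
open Summit.QuantumFields.YangMills.Theorems.FemtoTransferGap.FlatSheet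
open Summit.QuantumFields.YangMills.Theorems.FemtoTransferGap.TwoLattice.TowerA

variable {L : ℕ} [NeZero L]

/-! ## §1 Telescoping along the good chain -/

omit [NeZero L] in
/-- On a chain with linkwise `t`-close consecutive slices, slice `k` is linkwise `kt`-close to slice `0`. [folklore] -/
theorem frobNorm_slice_sub_zero_le {n : ℕ} (Us : Fin (n + 1) → GaugeConfig 3 L SU2) {t : ℝ}
    (h : ∀ (i : Fin n) (e : Edge 3 L), frobNorm (((Us i.castSucc e : SU2) : Matrix (Fin 2) (Fin 2) ℂ) - ((Us i.succ e : SU2) : Matrix (Fin 2) (Fin 2) ℂ)) ≤ t) :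
    ∀ (k : ℕ) (hk : k < n + 1) (e : Edge 3 L),
      frobNorm (((Us ⟨k, hk⟩ e : SU2) : Matrix (Fin 2) (Fin 2) ℂ) - ((Us 0 e : SU2) : Matrix (Fin 2) (Fin 2) ℂ)) ≤ k * t := by
  intro k
  induction k with
  | zero => intro hk e; simp [frobNorm_zero]
  | succ k ih =>
    intro hk e
    have hk' : k < n + 1 := by omega
    have hkn : k < n := by omega
    have hstep := h ⟨k, hkn⟩ e
    have hs : (⟨k, hkn⟩ : Fin n).succ = ⟨k + 1, hk⟩ := rfl
    have hc : (⟨k, hkn⟩ : Fin n).castSucc = ⟨k, hk'⟩ := rfl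
    rw [hs, hc] at hstep
    rw [← frobNorm_neg, neg_sub] at hstep
    calc frobNorm (((Us ⟨k + 1, hk⟩ e : SU2) : Matrix (Fin 2) (Fin 2) ℂ) - ((Us 0 e : SU2) : Matrix (Fin 2) (Fin 2) ℂ))
        = frobNorm ((((Us ⟨k + 1, hk⟩ e : SU2) : Matrix (Fin 2) (Fin 2) ℂ) - ((Us ⟨k, hk'⟩ e : SU2) : Matrix (Fin 2) (Fin 2) ℂ)) +
            (((Us ⟨k, hk'⟩ e : SU2) : Matrix (Fin 2) (Fin 2) ℂ) - ((Us 0 e : SU2) : Matrix (Fin 2) (Fin 2) ℂ))) := by rw [sub_add_sub_cancel]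
      _ ≤ t + k * t := (frobNorm_add_le _ _).trans (add_le_add hstep (ih hk' e))
      _ = (k + 1 : ℕ) * t := by push_cast; ring

omit [NeZero L] in
/-- **The `x`-holonomy trace moves little along the good chain**: `|Re tr P_x(U_k) − Re tr P_x(U_0)| ≤ 2Lkt`. [cite: Luscher1983, §2] -/
theorem abs_reTrace_slice_sub_zero_le {n : ℕ} (Us : Fin (n + 1) → GaugeConfig 3 L SU2) {t : ℝ}
    (h : ∀ (i : Fin n) (e : Edge 3 L), frobNorm (((Us i.castSucc e : SU2) : Matrix (Fin 2) (Fin 2) ℂ) - ((Us i.succ e : SU2) : Matrix (Fin 2) (Fin 2) ℂ)) ≤ t)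
    (k : ℕ) (hk : k < n + 1) :
    |((polyX (Us ⟨k, hk⟩) : SU2) : Matrix (Fin 2) (Fin 2) ℂ).trace.re - ((polyX (Us 0) : SU2) : Matrix (Fin 2) (Fin 2) ℂ).trace.re| ≤ 2 * L * (k * t) := by
  have h1 := frobNorm_polyXAux_sub_le (Us ⟨k, hk⟩) (Us 0) L
  have h2 : ∑ j ∈ Finset.range L, frobNorm (((Us ⟨k, hk⟩ (lineEdge L j) : SU2) : Matrix (Fin 2) (Fin 2) ℂ) -
      ((Us 0 (lineEdge L j) : SU2) : Matrix (Fin 2) (Fin 2) ℂ)) ≤ L * (k * t) := by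
    calc ∑ j ∈ Finset.range L, frobNorm (((Us ⟨k, hk⟩ (lineEdge L j) : SU2) : Matrix (Fin 2) (Fin 2) ℂ) - ((Us 0 (lineEdge L j) : SU2) : Matrix (Fin 2) (Fin 2) ℂ))
        ≤ ∑ _j ∈ Finset.range L, k * t := Finset.sum_le_sum fun j _ => frobNorm_slice_sub_zero_le Us h k hk _
      _ = L * (k * t) := by rw [Finset.sum_const, Finset.card_range, nsmul_eq_mul]
  have h3 := abs_re_trace_le_two_mul_frobNorm (((polyX (Us ⟨k, hk⟩) : SU2) : Matrix (Fin 2) (Fin 2) ℂ) - ((polyX (Us 0) : SU2) : Matrix (Fin 2) (Fin 2) ℂ))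
  rw [Matrix.trace_sub, Complex.sub_re] at h3
  have h4 : frobNorm (((polyX (Us ⟨k, hk⟩) : SU2) : Matrix (Fin 2) (Fin 2) ℂ) - ((polyX (Us 0) : SU2) : Matrix (Fin 2) (Fin 2) ℂ)) ≤ L * (k * t) :=
    h1.trans h2
  linarith

/-! ## §2 Pointwise reductions to the slice-`0` band or the bad fields -/

/-- The sign-flip indicator between slices `0` and `k` is dominated by the slice-`0` band `{|Re tr P_x| ≤ τ₀}` (`τ₀ ≥ 2Lkt`) plus the bad fields.
[cite: Luscher1983, §2] -/
theorem flipInd_le_band_add_bad {n : ℕ} (z : Fin 3 → Bool) (s : ℝ) {t τ₀ : ℝ} (k : ℕ) (hk : k < n + 1) (hτ₀ : 2 * L * (k * t) ≤ τ₀)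
    (Us : Fin (n + 1) → GaugeConfig 3 L SU2) (g : Site 3 L → SU2) :
    {b : GaugeConfig 3 L SU2 | Real.sign (((polyX b : SU2) : Matrix (Fin 2) (Fin 2) ℂ).trace.re) ≠
        Real.sign (((polyX (Us 0) : SU2) : Matrix (Fin 2) (Fin 2) ℂ).trace.re)}.indicator (fun _ => (1 : ℝ)) (Us ⟨k, hk⟩) ≤
      {U : GaugeConfig 3 L SU2 | |((polyX U : SU2) : Matrix (Fin 2) (Fin 2) ℂ).trace.re| ≤ τ₀}.indicator (fun _ => (1 : ℝ)) (Us 0) +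
        (goodEvent (L := L) n z s t)ᶜ.indicator (fun _ => (1 : ℝ)) (g, Us) := by
  have h0B := FluxReflection.ind_nonneg {U : GaugeConfig 3 L SU2 | |((polyX U : SU2) : Matrix (Fin 2) (Fin 2) ℂ).trace.re| ≤ τ₀} (Us 0)
  have h0G := FluxReflection.ind_nonneg (goodEvent (L := L) n z s t)ᶜ (g, Us)
  by_cases hgood : (g, Us) ∈ goodEvent (L := L) n z s t
  · by_cases hfl : Us ⟨k, hk⟩ ∈ {b : GaugeConfig 3 L SU2 | Real.sign (((polyX b : SU2) : Matrix (Fin 2) (Fin 2) ℂ).trace.re) ≠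
        Real.sign (((polyX (Us 0) : SU2) : Matrix (Fin 2) (Fin 2) ℂ).trace.re)}
    · rw [Set.indicator_of_mem hfl]
      obtain ⟨-, hbond, -⟩ := (mem_goodEvent_iff n z s t (g, Us)).1 hgood
      have hdiff := abs_reTrace_slice_sub_zero_le Us hbond k hk
      have hsmall : |((polyX (Us 0) : SU2) : Matrix (Fin 2) (Fin 2) ℂ).trace.re| ≤ τ₀ := by
        have h := FemtoTransferGap.TT.abs_le_abs_sub_of_sign_ne (Ne.symm hfl)
        rw [abs_sub_comm] at hdiff
        linarith
      rw [Set.indicator_of_mem (show Us 0 ∈ {U : GaugeConfig 3 L SU2 | |((polyX U : SU2) : Matrix (Fin 2) (Fin 2) ℂ).trace.re| ≤ τ₀} from hsmall)]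
      linarith
    · rw [Set.indicator_of_notMem hfl]; linarith
  · rw [Set.indicator_of_mem (show (g, Us) ∈ (goodEvent (L := L) n z s t)ᶜ from hgood)]
    linarith [FluxReflection.ind_le_one {b : GaugeConfig 3 L SU2 | Real.sign (((polyX b : SU2) : Matrix (Fin 2) (Fin 2) ℂ).trace.re) ≠
        Real.sign (((polyX (Us 0) : SU2) : Matrix (Fin 2) (Fin 2) ℂ).trace.re)} (Us ⟨k, hk⟩)]

omit [NeZero L] in
/-- The zero-trace indicator at slice `0` lies in every band of non-negative width. [folklore] -/
theorem zeroInd_le_band {τ₀ : ℝ} (hτ₀ : 0 ≤ τ₀) (U : GaugeConfig 3 L SU2) :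
    {y : GaugeConfig 3 L SU2 | Real.sign (((polyX y : SU2) : Matrix (Fin 2) (Fin 2) ℂ).trace.re) = 0}.indicator (fun _ => (1 : ℝ)) U ≤
      {U : GaugeConfig 3 L SU2 | |((polyX U : SU2) : Matrix (Fin 2) (Fin 2) ℂ).trace.re| ≤ τ₀}.indicator (fun _ => (1 : ℝ)) U := by
  by_cases h : U ∈ {y : GaugeConfig 3 L SU2 | Real.sign (((polyX y : SU2) : Matrix (Fin 2) (Fin 2) ℂ).trace.re) = 0}
  · have hz : ((polyX U : SU2) : Matrix (Fin 2) (Fin 2) ℂ).trace.re = 0 := Real.sign_eq_zero_iff.1 h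
    rw [Set.indicator_of_mem h, Set.indicator_of_mem (by simp [hz, hτ₀])]
  · rw [Set.indicator_of_notMem h]; exact FluxReflection.ind_nonneg _ _

/-- The thin band at slice `k` is dominated by a wider band at slice `0` (`τ₀ ≥ τ + 2Lkt`) plus the bad fields. [cite: Luscher1983, §2] -/
theorem bandInd_le_band_add_bad {n : ℕ} (z : Fin 3 → Bool) (s : ℝ) {t τ τ₀ : ℝ} (k : ℕ) (hk : k < n + 1) (hτ₀ : τ + 2 * L * (k * t) ≤ τ₀)
    (Us : Fin (n + 1) → GaugeConfig 3 L SU2) (g : Site 3 L → SU2) :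
    {U : GaugeConfig 3 L SU2 | |((polyX U : SU2) : Matrix (Fin 2) (Fin 2) ℂ).trace.re| ≤ τ}.indicator (fun _ => (1 : ℝ)) (Us ⟨k, hk⟩) ≤
      {U : GaugeConfig 3 L SU2 | |((polyX U : SU2) : Matrix (Fin 2) (Fin 2) ℂ).trace.re| ≤ τ₀}.indicator (fun _ => (1 : ℝ)) (Us 0) +
        (goodEvent (L := L) n z s t)ᶜ.indicator (fun _ => (1 : ℝ)) (g, Us) := by
  have h0B := FluxReflection.ind_nonneg {U : GaugeConfig 3 L SU2 | |((polyX U : SU2) : Matrix (Fin 2) (Fin 2) ℂ).trace.re| ≤ τ₀} (Us 0)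
  have h0G := FluxReflection.ind_nonneg (goodEvent (L := L) n z s t)ᶜ (g, Us)
  by_cases hgood : (g, Us) ∈ goodEvent (L := L) n z s t
  · by_cases hb : Us ⟨k, hk⟩ ∈ {U : GaugeConfig 3 L SU2 | |((polyX U : SU2) : Matrix (Fin 2) (Fin 2) ℂ).trace.re| ≤ τ}
    · rw [Set.indicator_of_mem hb]
      obtain ⟨-, hbond, -⟩ := (mem_goodEvent_iff n z s t (g, Us)).1 hgood
      have hdiff := abs_reTrace_slice_sub_zero_le Us hbond k hk
      have hb' : |((polyX (Us ⟨k, hk⟩) : SU2) : Matrix (Fin 2) (Fin 2) ℂ).trace.re| ≤ τ := hb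
      have hsmall : |((polyX (Us 0) : SU2) : Matrix (Fin 2) (Fin 2) ℂ).trace.re| ≤ τ₀ := by
        have := abs_sub_abs_le_abs_sub (((polyX (Us 0) : SU2) : Matrix (Fin 2) (Fin 2) ℂ).trace.re) (((polyX (Us ⟨k, hk⟩) : SU2) : Matrix (Fin 2) (Fin 2) ℂ).trace.re)
        rw [abs_sub_comm] at this
        linarith
      rw [Set.indicator_of_mem (show Us 0 ∈ {U : GaugeConfig 3 L SU2 | |((polyX U : SU2) : Matrix (Fin 2) (Fin 2) ℂ).trace.re| ≤ τ₀} from hsmall)]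
      linarith
    · rw [Set.indicator_of_notMem hb]; linarith
  · rw [Set.indicator_of_mem (show (g, Us) ∈ (goodEvent (L := L) n z s t)ᶜ from hgood)]
    linarith [FluxReflection.ind_le_one {U : GaugeConfig 3 L SU2 | |((polyX U : SU2) : Matrix (Fin 2) (Fin 2) ℂ).trace.re| ≤ τ} (Us ⟨k, hk⟩)]

/-- The far-bond indicator of an interior bond is a bad field. [folklore] -/
theorem farInd_le_bad {n : ℕ} (z : Fin 3 → Bool) (s t : ℝ) (i : Fin n) (Us : Fin (n + 1) → GaugeConfig 3 L SU2) (g : Site 3 L → SU2) :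
    {p : GaugeConfig 3 L SU2 × GaugeConfig 3 L SU2 |
        ∃ e, t < frobNorm ((p.1 e : Matrix (Fin 2) (Fin 2) ℂ) - (p.2 e : Matrix (Fin 2) (Fin 2) ℂ))}ᶜᶜ.indicator (fun _ => (1 : ℝ)) (Us i.castSucc, Us i.succ) ≤
      (goodEvent (L := L) n z s t)ᶜ.indicator (fun _ => (1 : ℝ)) (g, Us) := by
  rw [compl_compl]
  by_cases hfar : (Us i.castSucc, Us i.succ) ∈ {p : GaugeConfig 3 L SU2 × GaugeConfig 3 L SU2 |
      ∃ e, t < frobNorm ((p.1 e : Matrix (Fin 2) (Fin 2) ℂ) - (p.2 e : Matrix (Fin 2) (Fin 2) ℂ))}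
  · have hbad : (g, Us) ∈ (goodEvent (L := L) n z s t)ᶜ := by
      intro hgood
      obtain ⟨-, hbond, -⟩ := (mem_goodEvent_iff n z s t (g, Us)).1 hgood
      obtain ⟨e, he⟩ := hfar
      exact absurd (hbond i e) (not_le.2 he)
    rw [Set.indicator_of_mem hfar, Set.indicator_of_mem hbad]
  · rw [Set.indicator_of_notMem hfar]; exact FluxReflection.ind_nonneg _ _

/-! ## §3 The assembled bounds -/

/-- Monotonicity of `√`-combinations: `2√a + √b ≤ 3√c` when `a, b ≤ c`. [folklore] -/
theorem two_sqrt_add_sqrt_le {a b c : ℝ} (ha : a ≤ c) (hb : b ≤ c) : 2 * Real.sqrt a + Real.sqrt b ≤ 3 * Real.sqrt c := by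
  have h1 := Real.sqrt_le_sqrt ha
  have h2 := Real.sqrt_le_sqrt hb
  linarith

set_option maxHeartbeats 800000 in
/-- ★ **Flux suppression input, odd ring** (`2q+3` slices, written `1 + (q+1+q)`): for an `x`-twisted sector `z` (`z 0 = true`), `β ≥ 0`, `t ≥ 0`,
with the slice-`0` equator band `B = {|Re tr P_x| ≤ 2L(q+3)t}` and the good-field events of the untwisted and of the twisted sector,
`W_z(1) ≤ 3 √W_0(1) √(W_0(𝟙_B(U₀)) + W_0(goodᶜ)) + (W_0(𝟙_B(U₀)) + W_0(goodᶜ)) + W_z(goodᶜ)`. [cite: tHooft1979] [cite: Luscher1983, §2] -/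
theorem sectorWeight_twisted_le_band_odd {β : ℝ} (hβ : 0 ≤ β) {z : Fin 3 → Bool} (hz : z 0 = true) (q : ℕ) (s : ℝ) {t : ℝ} (ht : 0 ≤ t) :
    sectorWeight (L := L) β (1 + (q + 1 + q)) z (fun _ _ => (1 : ℝ)) ≤
      3 * Real.sqrt (sectorWeight (L := L) β (1 + (q + 1 + q)) (fun _ => false) (fun _ _ => (1 : ℝ))) *
          Real.sqrt (sectorWeight (L := L) β (1 + (q + 1 + q)) (fun _ => false) (fun Us _ => {U : GaugeConfig 3 L SU2 | |((polyX U : SU2) : Matrix (Fin 2) (Fin 2) ℂ).trace.re| ≤ (2 * L * ((q + 3) * t))}.indicator (fun _ => (1 : ℝ)) (Us 0)) +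
            sectorWeight (L := L) β (1 + (q + 1 + q)) (fun _ => false) (fun Us g => (goodEvent (L := L) (1 + (q + 1 + q)) (fun _ => false) s t)ᶜ.indicator (fun _ => (1 : ℝ)) (g, Us))) +
        (sectorWeight (L := L) β (1 + (q + 1 + q)) (fun _ => false) (fun Us _ => {U : GaugeConfig 3 L SU2 | |((polyX U : SU2) : Matrix (Fin 2) (Fin 2) ℂ).trace.re| ≤ (2 * L * ((q + 3) * t))}.indicator (fun _ => (1 : ℝ)) (Us 0)) +
          sectorWeight (L := L) β (1 + (q + 1 + q)) (fun _ => false) (fun Us g => (goodEvent (L := L) (1 + (q + 1 + q)) (fun _ => false) s t)ᶜ.indicator (fun _ => (1 : ℝ)) (g, Us))) +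
        sectorWeight (L := L) β (1 + (q + 1 + q)) z (fun Us g => (goodEvent (L := L) (1 + (q + 1 + q)) z s t)ᶜ.indicator (fun _ => (1 : ℝ)) (g, Us)) := by
  haveI : SecondCountableTopology SU2 := secondCountableTopology_su2
  have hLt : 2 * (L : ℝ) * t ≤ 2 * L * t := le_rfl
  have key := sectorWeight_twisted_le_flip_odd (L := L) hβ hz q hLt
  have hq1 : q + 1 < 1 + (q + 1 + q) + 1 := by omega
  have hq2 : q + 2 < 1 + (q + 1 + q) + 1 := by omega
  -- measurability and bounds of the functionals
  have hOm := measurable_signBit (L := L)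
  have hpi : ∀ i : Fin (1 + (q + 1 + q) + 1), Measurable fun p : (Fin (1 + (q + 1 + q) + 1) → GaugeConfig 3 L SU2) × (Site 3 L → SU2) => p.1 i :=
    fun i => (measurable_pi_apply i).comp measurable_fst
  have hBm : ∀ τ : ℝ, MeasurableSet {U : GaugeConfig 3 L SU2 | |((polyX U : SU2) : Matrix (Fin 2) (Fin 2) ℂ).trace.re| ≤ τ} :=
    fun τ => measurableSet_reTraceBand (L := L) τ
  have mGood : ∀ w : Fin 3 → Bool, Measurable (uncurry fun (Us : Fin (1 + (q + 1 + q) + 1) → GaugeConfig 3 L SU2) (g : Site 3 L → SU2) => (goodEvent (L := L) (1 + (q + 1 + q)) w s t)ᶜ.indicator (fun _ => (1 : ℝ)) (g, Us)) :=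
    fun w => (measurable_const.indicator (measurableSet_goodEvent (L := L) (1 + (q + 1 + q)) w s t).compl).comp (measurable_snd.prodMk measurable_fst)
  have mBand0 : Measurable (uncurry fun (Us : Fin (1 + (q + 1 + q) + 1) → GaugeConfig 3 L SU2) (_g : Site 3 L → SU2) => {U : GaugeConfig 3 L SU2 | |((polyX U : SU2) : Matrix (Fin 2) (Fin 2) ℂ).trace.re| ≤ (2 * L * ((q + 3) * t))}.indicator (fun _ => (1 : ℝ)) (Us 0)) :=
    (measurable_const.indicator (hBm _)).comp (hpi 0)
  have mSum : Measurable (uncurry fun (Us : Fin (1 + (q + 1 + q) + 1) → GaugeConfig 3 L SU2) (g : Site 3 L → SU2) =>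
      {U : GaugeConfig 3 L SU2 | |((polyX U : SU2) : Matrix (Fin 2) (Fin 2) ℂ).trace.re| ≤ (2 * L * ((q + 3) * t))}.indicator (fun _ => (1 : ℝ)) (Us 0) + (goodEvent (L := L) (1 + (q + 1 + q)) (fun _ => false) s t)ᶜ.indicator (fun _ => (1 : ℝ)) (g, Us)) := mBand0.add (mGood _)
  have b1 : ∀ (S : Set (GaugeConfig 3 L SU2)) (U : GaugeConfig 3 L SU2), |S.indicator (fun _ => (1 : ℝ)) U| ≤ 2 :=
    fun S U => (FluxReflection.abs_ind_le_one S U).trans (by norm_num)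
  have bSum : ∀ (Us : Fin (1 + (q + 1 + q) + 1) → GaugeConfig 3 L SU2) (g : Site 3 L → SU2),
      |{U : GaugeConfig 3 L SU2 | |((polyX U : SU2) : Matrix (Fin 2) (Fin 2) ℂ).trace.re| ≤ (2 * L * ((q + 3) * t))}.indicator (fun _ => (1 : ℝ)) (Us 0) + (goodEvent (L := L) (1 + (q + 1 + q)) (fun _ => false) s t)ᶜ.indicator (fun _ => (1 : ℝ)) (g, Us)| ≤ 2 := fun Us g =>
    (abs_add_le _ _).trans (by linarith [FluxReflection.abs_ind_le_one {U : GaugeConfig 3 L SU2 | |((polyX U : SU2) : Matrix (Fin 2) (Fin 2) ℂ).trace.re| ≤ (2 * L * ((q + 3) * t))} (Us 0),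
      FluxReflection.abs_ind_le_one (goodEvent (L := L) (1 + (q + 1 + q)) (fun _ => false) s t)ᶜ (g, Us)])
  have eSum : sectorWeight (L := L) β (1 + (q + 1 + q)) (fun _ => false) (fun Us g => {U : GaugeConfig 3 L SU2 | |((polyX U : SU2) : Matrix (Fin 2) (Fin 2) ℂ).trace.re| ≤ (2 * L * ((q + 3) * t))}.indicator (fun _ => (1 : ℝ)) (Us 0) + (goodEvent (L := L) (1 + (q + 1 + q)) (fun _ => false) s t)ᶜ.indicator (fun _ => (1 : ℝ)) (g, Us)) =
      sectorWeight (L := L) β (1 + (q + 1 + q)) (fun _ => false) (fun Us _ => {U : GaugeConfig 3 L SU2 | |((polyX U : SU2) : Matrix (Fin 2) (Fin 2) ℂ).trace.re| ≤ (2 * L * ((q + 3) * t))}.indicator (fun _ => (1 : ℝ)) (Us 0)) +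
        sectorWeight (L := L) β (1 + (q + 1 + q)) (fun _ => false) (fun Us g => (goodEvent (L := L) (1 + (q + 1 + q)) (fun _ => false) s t)ᶜ.indicator (fun _ => (1 : ℝ)) (g, Us)) :=
    sectorWeight_add β _ _ mBand0 (mGood _) (fun Us _ => FluxReflection.abs_ind_le_one _ (Us 0)) (fun Us g => FluxReflection.abs_ind_le_one _ (g, Us))
  -- (1) the flip term
  have mFlip : Measurable (uncurry fun (Us : Fin (1 + (q + 1 + q) + 1) → GaugeConfig 3 L SU2) (_g : Site 3 L → SU2) =>
      {b : GaugeConfig 3 L SU2 | Real.sign (((polyX b : SU2) : Matrix (Fin 2) (Fin 2) ℂ).trace.re) ≠ Real.sign (((polyX (Us 0) : SU2) : Matrix (Fin 2) (Fin 2) ℂ).trace.re)}.indicator (fun _ => (1 : ℝ)) (Us ⟨q + 1, hq1⟩) * {b : GaugeConfig 3 L SU2 | Real.sign (((polyX b : SU2) : Matrix (Fin 2) (Fin 2) ℂ).trace.re) ≠ Real.sign (((polyX (Us 0) : SU2) : Matrix (Fin 2) (Fin 2) ℂ).trace.re)}.indicator (fun _ => (1 : ℝ)) (Us ⟨q + 2,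 hq2⟩)) := by
    have h1 := (FluxReflection.measurable_flipInd hOm).comp ((hpi 0).prodMk (hpi ⟨q + 1, hq1⟩))
    have h2 := (FluxReflection.measurable_flipInd hOm).comp ((hpi 0).prodMk (hpi ⟨q + 2, hq2⟩))
    exact h1.mul h2
  have hflip : sectorWeight (L := L) β (1 + (q + 1 + q)) (fun _ => false) (fun Us _ => {b : GaugeConfig 3 L SU2 | Real.sign (((polyX b : SU2) : Matrix (Fin 2) (Fin 2) ℂ).trace.re) ≠ Real.sign (((polyX (Us 0) : SU2) : Matrix (Fin 2) (Fin 2) ℂ).trace.re)}.indicator (fun _ => (1 : ℝ)) (Us ⟨q + 1, hq1⟩) * {b : GaugeConfig 3 L SU2 | Real.sign (((polyX b : SU2) : Matrix (Fin 2) (Fin 2) ℂ).trace.re) ≠ Real.sign (((polyX (Us 0) : SU2) : Matrix (Fin 2) (Fin 2) ℂ).trace.re)}.indicator (fun _ => (1 : ℝ)) (Us ⟨q + 2, hq2⟩)) ≤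
      sectorWeight (L := L) β (1 + (q + 1 + q)) (fun _ => false) (fun Us _ => {U : GaugeConfig 3 L SU2 | |((polyX U : SU2) : Matrix (Fin 2) (Fin 2) ℂ).trace.re| ≤ (2 * L * ((q + 3) * t))}.indicator (fun _ => (1 : ℝ)) (Us 0)) +
        sectorWeight (L := L) β (1 + (q + 1 + q)) (fun _ => false) (fun Us g => (goodEvent (L := L) (1 + (q + 1 + q)) (fun _ => false) s t)ᶜ.indicator (fun _ => (1 : ℝ)) (g, Us)) := by
    rw [← eSum]
    refine sectorWeight_mono β _ _ mFlip mSum (fun Us _ => ?_) bSum (fun Us g => ?_)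
    · rw [abs_mul]
      exact (mul_le_mul (FluxReflection.abs_ind_le_one _ _) (FluxReflection.abs_ind_le_one _ _) (abs_nonneg _) zero_le_one).trans (by norm_num)
    · have hτ₀ : 2 * (L : ℝ) * ((q + 1 : ℕ) * t) ≤ (2 * L * ((q + 3) * t)) := by
        have hL0 : (0 : ℝ) ≤ L := Nat.cast_nonneg L
        push_cast; nlinarith
      have h := flipInd_le_band_add_bad (L := L) (fun _ => false) s (q + 1) hq1 hτ₀ Us g
      refine le_trans ?_ h
      exact mul_le_of_le_one_right (FluxReflection.ind_nonneg _ _) (FluxReflection.ind_le_one _ _)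
  -- (2) the zero term
  have mZero : Measurable (uncurry fun (Us : Fin (1 + (q + 1 + q) + 1) → GaugeConfig 3 L SU2) (_g : Site 3 L → SU2) => {y : GaugeConfig 3 L SU2 | Real.sign (((polyX y : SU2) : Matrix (Fin 2) (Fin 2) ℂ).trace.re) = 0}.indicator (fun _ => (1 : ℝ)) (Us 0)) :=
    (measurable_const.indicator (measurableSet_eq_fun hOm measurable_const)).comp (hpi 0)
  have hzero : sectorWeight (L := L) β (1 + (q + 1 + q)) (fun _ => false) (fun Us _ => {y : GaugeConfig 3 L SU2 | Real.sign (((polyX y : SU2) : Matrix (Fin 2) (Fin 2) ℂ).trace.re) = 0}.indicator (fun _ => (1 : ℝ)) (Us 0)) ≤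
      sectorWeight (L := L) β (1 + (q + 1 + q)) (fun _ => false) (fun Us _ => {U : GaugeConfig 3 L SU2 | |((polyX U : SU2) : Matrix (Fin 2) (Fin 2) ℂ).trace.re| ≤ (2 * L * ((q + 3) * t))}.indicator (fun _ => (1 : ℝ)) (Us 0)) :=
    sectorWeight_mono β _ _ mZero mBand0 (fun Us _ => FluxReflection.abs_ind_le_one _ (Us 0)) (fun Us _ => FluxReflection.abs_ind_le_one _ (Us 0))
      (fun Us _ => zeroInd_le_band (by positivity) (Us 0))
  -- (3) the band term
  have mBand2 : Measurable (uncurry fun (Us : Fin (1 + (q + 1 + q) + 1) → GaugeConfig 3 L SU2) (_g : Site 3 L → SU2) =>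
      {U : GaugeConfig 3 L SU2 | |((polyX U : SU2) : Matrix (Fin 2) (Fin 2) ℂ).trace.re| ≤ 2 * L * t}.indicator (fun _ => (1 : ℝ)) (Us ⟨q + 1, hq1⟩) * {U : GaugeConfig 3 L SU2 | |((polyX U : SU2) : Matrix (Fin 2) (Fin 2) ℂ).trace.re| ≤ 2 * L * t}.indicator (fun _ => (1 : ℝ)) (Us ⟨q + 2, hq2⟩)) :=
    ((measurable_const.indicator (hBm _)).comp (hpi ⟨q + 1, hq1⟩)).mul ((measurable_const.indicator (hBm _)).comp (hpi ⟨q + 2, hq2⟩))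
  have hband : sectorWeight (L := L) β (1 + (q + 1 + q)) (fun _ => false) (fun Us _ => {U : GaugeConfig 3 L SU2 | |((polyX U : SU2) : Matrix (Fin 2) (Fin 2) ℂ).trace.re| ≤ 2 * L * t}.indicator (fun _ => (1 : ℝ)) (Us ⟨q + 1, hq1⟩) * {U : GaugeConfig 3 L SU2 | |((polyX U : SU2) : Matrix (Fin 2) (Fin 2) ℂ).trace.re| ≤ 2 * L * t}.indicator (fun _ => (1 : ℝ)) (Us ⟨q + 2, hq2⟩)) ≤
      sectorWeight (L := L) β (1 + (q + 1 + q)) (fun _ => false) (fun Us _ => {U : GaugeConfig 3 L SU2 | |((polyX U : SU2) : Matrix (Fin 2) (Fin 2) ℂ).trace.re| ≤ (2 * L * ((q + 3) * t))}.indicator (fun _ => (1 : ℝ)) (Us 0)) +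
        sectorWeight (L := L) β (1 + (q + 1 + q)) (fun _ => false) (fun Us g => (goodEvent (L := L) (1 + (q + 1 + q)) (fun _ => false) s t)ᶜ.indicator (fun _ => (1 : ℝ)) (g, Us)) := by
    rw [← eSum]
    refine sectorWeight_mono β _ _ mBand2 mSum (fun Us _ => ?_) bSum (fun Us g => ?_)
    · rw [abs_mul]
      exact (mul_le_mul (FluxReflection.abs_ind_le_one _ _) (FluxReflection.abs_ind_le_one _ _) (abs_nonneg _) zero_le_one).trans (by norm_num)
    · have hτ₀ : 2 * (L : ℝ) * t + 2 * L * ((q + 1 : ℕ) * t) ≤ (2 * L * ((q + 3) * t)) := by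
        have hL0 : (0 : ℝ) ≤ L := Nat.cast_nonneg L
        push_cast; nlinarith
      have h := bandInd_le_band_add_bad (L := L) (fun _ => false) s (q + 1) hq1 hτ₀ Us g
      refine le_trans ?_ h
      exact mul_le_of_le_one_right (FluxReflection.ind_nonneg _ _) (FluxReflection.ind_le_one _ _)
  -- (4) the far bond
  have mFar : Measurable (uncurry fun (Us : Fin (1 + (q + 1 + q) + 1) → GaugeConfig 3 L SU2) (_g : Site 3 L → SU2) =>
      {p : GaugeConfig 3 L SU2 × GaugeConfig 3 L SU2 | ∃ e, t < frobNorm ((p.1 e : Matrix (Fin 2) (Fin 2) ℂ) - (p.2 e : Matrix (Fin 2) (Fin 2) ℂ))}ᶜᶜ.indicator (fun _ => (1 : ℝ)) (Us ⟨q + 1, hq1⟩, Us ⟨q + 2, hq2⟩)) :=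
    (measurable_const.indicator (FlatSheet.measurableSet_far (L := L) t).compl.compl).comp ((hpi ⟨q + 1, hq1⟩).prodMk (hpi ⟨q + 2, hq2⟩))
  have hfar : sectorWeight (L := L) β (1 + (q + 1 + q)) z (fun Us _ => {p : GaugeConfig 3 L SU2 × GaugeConfig 3 L SU2 | ∃ e, t < frobNorm ((p.1 e : Matrix (Fin 2) (Fin 2) ℂ) - (p.2 e : Matrix (Fin 2) (Fin 2) ℂ))}ᶜᶜ.indicator (fun _ => (1 : ℝ)) (Us ⟨q + 1, hq1⟩, Us ⟨q + 2, hq2⟩)) ≤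
      sectorWeight (L := L) β (1 + (q + 1 + q)) z (fun Us g => (goodEvent (L := L) (1 + (q + 1 + q)) z s t)ᶜ.indicator (fun _ => (1 : ℝ)) (g, Us)) := by
    refine sectorWeight_mono β _ _ mFar (mGood z) (fun Us _ => FluxReflection.abs_ind_le_one _ _) (fun Us g => FluxReflection.abs_ind_le_one _ _)
      (fun Us g => ?_)
    have hi : ((⟨q + 1, by omega⟩ : Fin (1 + (q + 1 + q))).castSucc : Fin (1 + (q + 1 + q) + 1)) = ⟨q + 1, hq1⟩ ∧
        ((⟨q + 1, by omega⟩ : Fin (1 + (q + 1 + q))).succ : Fin (1 + (q + 1 + q) + 1)) = ⟨q + 2, hq2⟩ := ⟨rfl, rfl⟩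
    have h := farInd_le_bad (L := L) z s t (⟨q + 1, by omega⟩ : Fin (1 + (q + 1 + q))) Us g
    rw [hi.1, hi.2] at h
    exact h
  -- assemble
  have hW1 : 0 ≤ Real.sqrt (sectorWeight (L := L) β (1 + (q + 1 + q)) (fun _ => false) (fun _ _ => (1 : ℝ))) := Real.sqrt_nonneg _
  have hG0 : 0 ≤ sectorWeight (L := L) β (1 + (q + 1 + q)) (fun _ => false) (fun Us g => (goodEvent (L := L) (1 + (q + 1 + q)) (fun _ => false) s t)ᶜ.indicator (fun _ => (1 : ℝ)) (g, Us)) :=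
    sectorWeight_nonneg β _ _ fun Us g => FluxReflection.ind_nonneg _ _
  have hsq := two_sqrt_add_sqrt_le hflip (hzero.trans (le_add_of_nonneg_right hG0))
  have hprod := mul_le_mul_of_nonneg_left hsq hW1
  nlinarith [hprod, hband, hfar, key]

set_option maxHeartbeats 800000 in
/-- ★ **Flux suppression input, even ring** (`2q+2` slices, written `1 + (q+q)`): for an `x`-twisted sector `z` (`z 0 = true`) and `t ≥ 0`,
`W_z(1) ≤ 3 √W_0(1) √(W_0(𝟙_B(U₀)) + W_0(goodᶜ))` with `B = {|Re tr P_x| ≤ 2L(q+3)t}`. [cite: tHooft1979] [cite: Luscher1983, §2] -/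
theorem sectorWeight_twisted_le_band_even (β : ℝ) {z : Fin 3 → Bool} (hz : z 0 = true) (q : ℕ) (s : ℝ) {t : ℝ} (ht : 0 ≤ t) :
    sectorWeight (L := L) β (1 + (q + q)) z (fun _ _ => (1 : ℝ)) ≤
      3 * Real.sqrt (sectorWeight (L := L) β (1 + (q + q)) (fun _ => false) (fun _ _ => (1 : ℝ))) *
        Real.sqrt (sectorWeight (L := L) β (1 + (q + q)) (fun _ => false) (fun Us _ => {U : GaugeConfig 3 L SU2 | |((polyX U : SU2) : Matrix (Fin 2) (Fin 2) ℂ).trace.re| ≤ (2 * L * ((q + 3) * t))}.indicator (fun _ => (1 : ℝ)) (Us 0)) +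
          sectorWeight (L := L) β (1 + (q + q)) (fun _ => false) (fun Us g => (goodEvent (L := L) (1 + (q + q)) (fun _ => false) s t)ᶜ.indicator (fun _ => (1 : ℝ)) (g, Us))) := by
  haveI : SecondCountableTopology SU2 := secondCountableTopology_su2
  have key := sectorWeight_twisted_le_flip_even (L := L) β hz q
  have hq1 : q + 1 < 1 + (q + q) + 1 := by omega
  have hOm := measurable_signBit (L := L)
  have hpi : ∀ i : Fin (1 + (q + q) + 1), Measurable fun p : (Fin (1 + (q + q) + 1) → GaugeConfig 3 L SU2) × (Site 3 L → SU2) => p.1 i :=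
    fun i => (measurable_pi_apply i).comp measurable_fst
  have hBm : ∀ τ : ℝ, MeasurableSet {U : GaugeConfig 3 L SU2 | |((polyX U : SU2) : Matrix (Fin 2) (Fin 2) ℂ).trace.re| ≤ τ} :=
    fun τ => measurableSet_reTraceBand (L := L) τ
  have mGood : Measurable (uncurry fun (Us : Fin (1 + (q + q) + 1) → GaugeConfig 3 L SU2) (g : Site 3 L → SU2) => (goodEvent (L := L) (1 + (q + q)) (fun _ => false) s t)ᶜ.indicator (fun _ => (1 : ℝ)) (g, Us)) :=
    (measurable_const.indicator (measurableSet_goodEvent (L := L) (1 + (q + q)) (fun _ => false) s t).compl).comp (measurable_snd.prodMk measurable_fst)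
  have mBand0 : Measurable (uncurry fun (Us : Fin (1 + (q + q) + 1) → GaugeConfig 3 L SU2) (_g : Site 3 L → SU2) => {U : GaugeConfig 3 L SU2 | |((polyX U : SU2) : Matrix (Fin 2) (Fin 2) ℂ).trace.re| ≤ (2 * L * ((q + 3) * t))}.indicator (fun _ => (1 : ℝ)) (Us 0)) :=
    (measurable_const.indicator (hBm _)).comp (hpi 0)
  have mSum : Measurable (uncurry fun (Us : Fin (1 + (q + q) + 1) → GaugeConfig 3 L SU2) (g : Site 3 L → SU2) =>
      {U : GaugeConfig 3 L SU2 | |((polyX U : SU2) : Matrix (Fin 2) (Fin 2) ℂ).trace.re| ≤ (2 * L * ((q + 3) * t))}.indicator (fun _ => (1 : ℝ)) (Us 0) + (goodEvent (L := L) (1 + (q + q)) (fun _ => false) s t)ᶜ.indicator (fun _ => (1 : ℝ)) (g, Us)) := mBand0.add mGood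
  have bSum : ∀ (Us : Fin (1 + (q + q) + 1) → GaugeConfig 3 L SU2) (g : Site 3 L → SU2),
      |{U : GaugeConfig 3 L SU2 | |((polyX U : SU2) : Matrix (Fin 2) (Fin 2) ℂ).trace.re| ≤ (2 * L * ((q + 3) * t))}.indicator (fun _ => (1 : ℝ)) (Us 0) + (goodEvent (L := L) (1 + (q + q)) (fun _ => false) s t)ᶜ.indicator (fun _ => (1 : ℝ)) (g, Us)| ≤ 2 := fun Us g =>
    (abs_add_le _ _).trans (by linarith [FluxReflection.abs_ind_le_one {U : GaugeConfig 3 L SU2 | |((polyX U : SU2) : Matrix (Fin 2) (Fin 2) ℂ).trace.re| ≤ (2 * L * ((q + 3) * t))} (Us 0),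
      FluxReflection.abs_ind_le_one (goodEvent (L := L) (1 + (q + q)) (fun _ => false) s t)ᶜ (g, Us)])
  have eSum : sectorWeight (L := L) β (1 + (q + q)) (fun _ => false) (fun Us g => {U : GaugeConfig 3 L SU2 | |((polyX U : SU2) : Matrix (Fin 2) (Fin 2) ℂ).trace.re| ≤ (2 * L * ((q + 3) * t))}.indicator (fun _ => (1 : ℝ)) (Us 0) + (goodEvent (L := L) (1 + (q + q)) (fun _ => false) s t)ᶜ.indicator (fun _ => (1 : ℝ)) (g, Us)) =
      sectorWeight (L := L) β (1 + (q + q)) (fun _ => false) (fun Us _ => {U : GaugeConfig 3 L SU2 | |((polyX U : SU2) : Matrix (Fin 2) (Fin 2) ℂ).trace.re| ≤ (2 * L * ((q + 3) * t))}.indicator (fun _ => (1 : ℝ)) (Us 0)) +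
        sectorWeight (L := L) β (1 + (q + q)) (fun _ => false) (fun Us g => (goodEvent (L := L) (1 + (q + q)) (fun _ => false) s t)ᶜ.indicator (fun _ => (1 : ℝ)) (g, Us)) :=
    sectorWeight_add β _ _ mBand0 mGood (fun Us _ => FluxReflection.abs_ind_le_one _ (Us 0)) (fun Us g => FluxReflection.abs_ind_le_one _ (g, Us))
  have mFlip : Measurable (uncurry fun (Us : Fin (1 + (q + q) + 1) → GaugeConfig 3 L SU2) (_g : Site 3 L → SU2) => {b : GaugeConfig 3 L SU2 | Real.sign (((polyX b : SU2) : Matrix (Fin 2) (Fin 2) ℂ).trace.re) ≠ Real.sign (((polyX (Us 0) : SU2) : Matrix (Fin 2) (Fin 2) ℂ).trace.re)}.indicator (fun _ => (1 : ℝ)) (Us ⟨q + 1, hq1⟩)) := by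
    have h1 := (FluxReflection.measurable_flipInd hOm).comp ((hpi 0).prodMk (hpi ⟨q + 1, hq1⟩)); exact h1
  have hflip : sectorWeight (L := L) β (1 + (q + q)) (fun _ => false) (fun Us _ => {b : GaugeConfig 3 L SU2 | Real.sign (((polyX b : SU2) : Matrix (Fin 2) (Fin 2) ℂ).trace.re) ≠ Real.sign (((polyX (Us 0) : SU2) : Matrix (Fin 2) (Fin 2) ℂ).trace.re)}.indicator (fun _ => (1 : ℝ)) (Us ⟨q + 1, hq1⟩)) ≤
      sectorWeight (L := L) β (1 + (q + q)) (fun _ => false) (fun Us _ => {U : GaugeConfig 3 L SU2 | |((polyX U : SU2) : Matrix (Fin 2) (Fin 2) ℂ).trace.re| ≤ (2 * L * ((q + 3) * t))}.indicator (fun _ => (1 : ℝ)) (Us 0)) +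
        sectorWeight (L := L) β (1 + (q + q)) (fun _ => false) (fun Us g => (goodEvent (L := L) (1 + (q + q)) (fun _ => false) s t)ᶜ.indicator (fun _ => (1 : ℝ)) (g, Us)) := by
    rw [← eSum]
    refine sectorWeight_mono β _ _ mFlip mSum (fun Us _ => (FluxReflection.abs_ind_le_one _ _).trans (by norm_num)) bSum (fun Us g => ?_)
    have hτ₀ : 2 * (L : ℝ) * ((q + 1 : ℕ) * t) ≤ (2 * L * ((q + 3) * t)) := by
      have hL0 : (0 : ℝ) ≤ L := Nat.cast_nonneg L
      push_cast; nlinarith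
    exact flipInd_le_band_add_bad (L := L) (fun _ => false) s (q + 1) hq1 hτ₀ Us g
  have mZero : Measurable (uncurry fun (Us : Fin (1 + (q + q) + 1) → GaugeConfig 3 L SU2) (_g : Site 3 L → SU2) => {y : GaugeConfig 3 L SU2 | Real.sign (((polyX y : SU2) : Matrix (Fin 2) (Fin 2) ℂ).trace.re) = 0}.indicator (fun _ => (1 : ℝ)) (Us 0)) :=
    (measurable_const.indicator (measurableSet_eq_fun hOm measurable_const)).comp (hpi 0)
  have hzero : sectorWeight (L := L) β (1 + (q + q)) (fun _ => false) (fun Us _ => {y : GaugeConfig 3 L SU2 | Real.sign (((polyX y : SU2) : Matrix (Fin 2) (Fin 2) ℂ).trace.re) = 0}.indicator (fun _ => (1 : ℝ)) (Us 0)) ≤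
      sectorWeight (L := L) β (1 + (q + q)) (fun _ => false) (fun Us _ => {U : GaugeConfig 3 L SU2 | |((polyX U : SU2) : Matrix (Fin 2) (Fin 2) ℂ).trace.re| ≤ (2 * L * ((q + 3) * t))}.indicator (fun _ => (1 : ℝ)) (Us 0)) :=
    sectorWeight_mono β _ _ mZero mBand0 (fun Us _ => FluxReflection.abs_ind_le_one _ (Us 0)) (fun Us _ => FluxReflection.abs_ind_le_one _ (Us 0))
      (fun Us _ => zeroInd_le_band (by positivity) (Us 0))
  have hW1 : 0 ≤ Real.sqrt (sectorWeight (L := L) β (1 + (q + q)) (fun _ => false) (fun _ _ => (1 : ℝ))) := Real.sqrt_nonneg _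
  have hG0 : 0 ≤ sectorWeight (L := L) β (1 + (q + q)) (fun _ => false) (fun Us g => (goodEvent (L := L) (1 + (q + q)) (fun _ => false) s t)ᶜ.indicator (fun _ => (1 : ℝ)) (g, Us)) :=
    sectorWeight_nonneg β _ _ fun Us g => FluxReflection.ind_nonneg _ _
  have hsq := two_sqrt_add_sqrt_le hflip (hzero.trans (le_add_of_nonneg_right hG0))
  have hprod := mul_le_mul_of_nonneg_left hsq hW1
  nlinarith [hprod, key]

end Summit.QuantumFields.YangMills.Theorems.FemtoTransferGap.TT

end
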